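import Summits.Ventures.PercRepro.S1TriangleCountBootSix
import Summits.Ventures.PercRepro.S1TriangleKernelFour

/-!
# PercRepro — THE TRIANGLE KERNEL AT NULLITY `5`, THE LEMMAS (p8, gen 23; a feeder for S4 — the top of the `q = 7`
window, the row `38`)

The re-based bootstrap (S1TriangleCountBootSix) gives `s₃ ≤ triBound6 5 = 9` at nullity `5`. The value `9` is never
attained. At the point `x` on the fewest triangles (`m := t_x`): `s₃ ≤ m + s₃(M ＼ {x}) ≤ m + 6` (the kernel at nullity
`4`) and `m(2m + 1) ≤ |U|·m ≤ 3·s₃` on `U := ⋃ triangles` force, for `s₃ = 9`, `m = 3` and `7 ≤ |U| ≤ 9`. The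
restriction `M ↾ U` has the same triangles, so its nullity `d_U` satisfies `9 ≤ triBound6 d_U`, i.e. `d_U ≥ 5`, and with
`r(U) ≥ 4` (seven points are not a plane, (C2)) this gives `|U| = 9`: the star of `x` (`7` points) plus two points
`q, q'`, and every point of `U` lies on exactly `3` triangles (the strict double count). The triangles through `q` avoid
`x` and meet each triangle `Cᵢ` through `x` in at most one point. THE TYPE-FINDING STEP (a pigeonhole): if a triangle
`{q, q', a}` through both exists, `a ∈ C_k`, the two other triangles through `q` avoid `q'` and `a`, so if each met
`C_k` they would share its one remaining point — hence one of them lies in `Cᵢ ∪ Cⱼ` (`{i, j, k} = {1, 2, 3}`); if no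
triangle contains both, the three triangles through `q` avoid `q'`, and if each met `C₁` two of them would share one of
its two points off `x` — hence one lies in `C₂ ∪ C₃`. The same for `q'` with the same pair, so `q, q' ∈ cl(Cᵢ ∪ Cⱼ)`:
a set of rank `≤ 3` (submodularity at `Cᵢ ∩ Cⱼ = {x}`) with `7` points, against (C2). The kernel itself is
`S1TriangleKernelFive.ncard_triangles_le_eight_of_nullity_five`; this module holds its lemmas: the strict double count,
the pigeonhole on the triangles through a point, the rank of two triangles through `x`, the restriction step (`|U| = 9`),
the final contradiction and the type-finding step. Axioms: standard.
-/

open scoped Matroid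

namespace PercRepro

namespace S1

open Set

variable {α : Type}

/-- **The double count, strict form**: if every point of `U = ⋃ triangles` lies on at least `m` triangles and some
point `x₀` of `U` lies on more than `m`, then `|U|·m + 1 ≤ 3·s₃`. -/
theorem ncard_sUnion_mul_add_one_le_three_mul_ncard_triangles (M : Matroid α) [M.Finite] {m : ℕ}
    (hm : ∀ x ∈ ⋃₀ ThmN.triangles M, m ≤ (ThmN.trianglesThrough M x).ncard)
    {x₀ : α} (hx₀ : x₀ ∈ ⋃₀ ThmN.triangles M) (hlt : m < (ThmN.trianglesThrough M x₀).ncard) :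
    (⋃₀ ThmN.triangles M).ncard * m + 1 ≤ 3 * (ThmN.triangles M).ncard := by
  classical
  have hTfin : (ThmN.triangles M).Finite :=
    M.ground_finite.finite_subsets.subset (fun C hC => hC.1.subset_ground)
  have hUE : ⋃₀ ThmN.triangles M ⊆ M.E := by
    intro z hz
    obtain ⟨C, hC, hzC⟩ := Set.mem_sUnion.1 hz
    exact hC.1.subset_ground hzC
  have hUfin : (⋃₀ ThmN.triangles M).Finite := M.ground_finite.subset hUE
  set Tf : Finset (Set α) := hTfin.toFinset with hTf
  set Uf : Finset α := hUfin.toFinset with hUf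
  have hmemT : ∀ C, C ∈ Tf ↔ C ∈ ThmN.triangles M := fun C => Set.Finite.mem_toFinset hTfin
  have hmemU : ∀ x, x ∈ Uf ↔ x ∈ ⋃₀ ThmN.triangles M := fun x => Set.Finite.mem_toFinset hUfin
  have hswap : ∑ x ∈ Uf, ∑ C ∈ Tf, (if x ∈ C then 1 else 0) =
      ∑ C ∈ Tf, ∑ x ∈ Uf, (if x ∈ C then 1 else 0) := Finset.sum_comm
  have hrow : ∀ C ∈ Tf, ∑ x ∈ Uf, (if x ∈ C then 1 else 0) = 3 := by
    intro C hC
    rw [Finset.sum_boole, Nat.cast_id]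
    have hCT : C ∈ ThmN.triangles M := (hmemT C).1 hC
    have hCfin : C.Finite := M.ground_finite.subset hCT.1.subset_ground
    have hfilter : (Uf.filter (fun x => x ∈ C)) = hCfin.toFinset := by
      ext x
      simp only [Finset.mem_filter, Set.Finite.mem_toFinset]
      constructor
      · rintro ⟨-, hx⟩; exact hx
      · intro hx
        exact ⟨(hmemU x).2 (Set.mem_sUnion.2 ⟨C, hCT, hx⟩), hx⟩
    rw [hfilter, ← Set.ncard_eq_toFinset_card C hCfin, hCT.2]
  have hcard : ∀ x, ∑ C ∈ Tf, (if x ∈ C then 1 else 0) = (ThmN.trianglesThrough M x).ncard := by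
    intro x
    rw [Finset.sum_boole, Nat.cast_id]
    have hfilter : ((Tf.filter (fun C => x ∈ C)) : Set (Set α)) = ThmN.trianglesThrough M x := by
      ext C
      simp only [Finset.coe_filter, Set.mem_setOf_eq, hmemT, ThmN.triangles, ThmN.trianglesThrough]
      tauto
    rw [← hfilter, Set.ncard_coe_finset]
  have hcol : ∀ x ∈ Uf, m ≤ ∑ C ∈ Tf, (if x ∈ C then 1 else 0) := by
    intro x hx
    rw [hcard x]
    exact hm x ((hmemU x).1 hx)
  have hleft : ∑ C ∈ Tf, ∑ x ∈ Uf, (if x ∈ C then 1 else 0) = 3 * (ThmN.triangles M).ncard := by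
    rw [Finset.sum_congr rfl hrow, Finset.sum_const, smul_eq_mul, hTf, ← Set.ncard_eq_toFinset_card _ hTfin,
      mul_comm]
  have hright : (⋃₀ ThmN.triangles M).ncard * m < ∑ x ∈ Uf, ∑ C ∈ Tf, (if x ∈ C then 1 else 0) := by
    calc (⋃₀ ThmN.triangles M).ncard * m = ∑ _x ∈ Uf, m := by
          rw [Finset.sum_const, smul_eq_mul, hUf, ← Set.ncard_eq_toFinset_card _ hUfin]
      _ < ∑ x ∈ Uf, ∑ C ∈ Tf, (if x ∈ C then 1 else 0) := by
          refine Finset.sum_lt_sum hcol ⟨x₀, (hmemU x₀).2 hx₀, ?_⟩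
          rw [hcard x₀]
          exact hlt
  rw [← hleft, ← hswap]
  exact hright

/-- **The pigeonhole on the triangles through `q`**: if a set `D ∌ q` is met by every member of a family `𝒯` of
triangles through `q` only inside a finset `K` with fewer elements than `𝒯`, some member of `𝒯` is disjoint from `D`
(two triangles through `q` meet only in `q`). -/
theorem exists_triangle_disjoint_of_card_lt (M : Matroid α) [M.Finite]
    (hC1 : ∀ L ⊆ M.E, M.eRk L = 2 → L.ncard ≤ 3) {q : α} (𝒯 : Finset (Set α))
    (h𝒯 : ∀ T ∈ 𝒯, T ∈ ThmN.trianglesThrough M q) {D : Set α} (hqD : q ∉ D) (K : Finset α)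
    (hK : ∀ T ∈ 𝒯, T ∩ D ⊆ ↑K) (hcard : K.card < 𝒯.card) : ∃ T ∈ 𝒯, T ∩ D = ∅ := by
  classical
  by_contra hcon
  push Not at hcon
  have hne : ∀ T ∈ 𝒯, (T ∩ D).Nonempty := hcon
  let f : Set α → α := fun T => if h : (T ∩ D).Nonempty then h.some else q
  have hf : ∀ T ∈ 𝒯, f T ∈ T ∩ D := by
    intro T hT
    have h := hne T hT
    simp only [f, dif_pos h]
    exact h.some_mem
  have hmaps : ∀ T ∈ 𝒯, f T ∈ K := fun T hT => hK T hT (hf T hT)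
  obtain ⟨T, hT, T', hT', hne', heq⟩ := Finset.exists_ne_map_eq_of_card_lt_of_maps_to hcard hmaps
  have h1 := hf T hT
  have h2 := hf T' hT'
  rw [heq] at h1
  have hmem : f T' ∈ T ∩ T' := ⟨h1.1, h2.1⟩
  rw [ThmN.inter_eq_singleton_of_mem_trianglesThrough M hC1 (h𝒯 T hT) (h𝒯 T' hT') hne'] at hmem
  rw [Set.mem_singleton_iff] at hmem
  rw [hmem] at h2
  exact hqD h2.2

/-- **Two triangles through `x` span a rank-`≤ 3` set** (submodularity at `x`). -/
theorem eRk_union_le_three_of_trianglesThrough (M : Matroid α) [M.Finite] {x : α} (hx : M.IsNonloop x)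
    {C C' : Set α} (hC : C ∈ ThmN.trianglesThrough M x) (hC' : C' ∈ ThmN.trianglesThrough M x) :
    M.eRk (C ∪ C') ≤ 3 := by
  have hrC := ThmN.eRk_eq_two_of_mem_trianglesThrough M hC
  have hrC' := ThmN.eRk_eq_two_of_mem_trianglesThrough M hC'
  have h1 : (1 : ℕ∞) ≤ M.eRk (C ∩ C') := by
    rw [← hx.eRk_eq]
    exact M.eRk_mono (Set.singleton_subset_iff.2 ⟨hC.2.2, hC'.2.2⟩)
  have hsubmod := M.eRk_inter_add_eRk_union_le C C'
  rw [hrC, hrC'] at hsubmod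
  have h2 : (1 : ℕ∞) + M.eRk (C ∪ C') ≤ 4 := by
    calc (1 : ℕ∞) + M.eRk (C ∪ C') ≤ M.eRk (C ∩ C') + M.eRk (C ∪ C') := add_le_add h1 le_rfl
      _ ≤ 2 + 2 := hsubmod
      _ = 4 := by norm_num
  have hfin : M.eRk (C ∪ C') ≠ ⊤ := by
    intro h
    rw [h] at h2
    exact absurd h2 (by simp)
  obtain ⟨r, hr⟩ := ENat.ne_top_iff_exists.1 hfin
  rw [← hr] at h2 ⊢
  have h2' : 1 + r ≤ 4 := by exact_mod_cast h2
  exact_mod_cast (show r ≤ 3 by omega)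

/-- **The restriction step.** If `s₃ = 9` and `7 ≤ |U| ≤ 9` for `U = ⋃ triangles`, then `|U| = 9`: the restriction
`M ↾ U` has the same triangles, so its nullity `d_U` has `9 ≤ triBound6 d_U`, i.e. `d_U ≥ 5`, and `r(U) ≥ 4` by (C2). -/
theorem ncard_sUnion_triangles_eq_nine (M : Matroid α) [M.Finite]
    (hC1 : ∀ L ⊆ M.E, M.eRk L = 2 → L.ncard ≤ 3)
    (hC2 : ∀ X ⊆ M.E, M.eRk X ≤ 3 → X.ncard ≤ 6)
    (hs9 : (ThmN.triangles M).ncard = 9) (hU7 : 7 ≤ (⋃₀ ThmN.triangles M).ncard)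
    (hU9 : (⋃₀ ThmN.triangles M).ncard ≤ 9) : (⋃₀ ThmN.triangles M).ncard = 9 := by
  classical
  have hUE : ⋃₀ ThmN.triangles M ⊆ M.E := by
    intro z hz
    obtain ⟨C, hC, hzC⟩ := Set.mem_sUnion.1 hz
    exact hC.1.subset_ground hzC
  have hUfin : (⋃₀ ThmN.triangles M).Finite := M.ground_finite.subset hUE
  set R := M ↾ (⋃₀ ThmN.triangles M) with hR
  haveI hRfinite : R.Finite := _root_.Matroid.restrict_finite hUfin
  have hRtri : ThmN.triangles R = ThmN.triangles M := by
    ext C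
    show R.IsCircuit C ∧ C.ncard = 3 ↔ M.IsCircuit C ∧ C.ncard = 3
    rw [hR, _root_.Matroid.restrict_isCircuit_iff hUE]
    constructor
    · rintro ⟨⟨hC, -⟩, h3⟩
      exact ⟨hC, h3⟩
    · rintro ⟨hC, h3⟩
      exact ⟨⟨hC, fun z hz => Set.mem_sUnion.2 ⟨C, ⟨hC, h3⟩, hz⟩⟩, h3⟩
  have hRC1 : ∀ L ⊆ R.E, R.eRk L = 2 → L.ncard ≤ 3 := by
    intro L hL hr
    rw [hR, _root_.Matroid.restrict_ground_eq] at hL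
    rw [hR, _root_.Matroid.restrict_eRk_eq M hL] at hr
    exact hC1 L (hL.trans hUE) hr
  have hRC2 : ∀ X ⊆ R.E, R.eRk X ≤ 3 → X.ncard ≤ 6 := by
    intro X hX hr
    rw [hR, _root_.Matroid.restrict_ground_eq] at hX
    rw [hR, _root_.Matroid.restrict_eRk_eq M hX] at hr
    exact hC2 X (hX.trans hUE) hr
  have hRfin : R✶.eRank ≠ ⊤ := PercRepro.Matroid.eRank_ne_top_of_finite R✶
  obtain ⟨dU, hdU⟩ := ENat.ne_top_iff_exists.1 hRfin
  have hdUenc : R.E.encard = R.eRank + dU := by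
    have h := _root_.Matroid.eRank_add_eRank_dual R
    rw [← hdU] at h
    exact h.symm
  have hRbound := ncard_triangles_le_triBound6 R hRC1 hRC2 hdUenc
  rw [hRtri, hs9] at hRbound
  have hdU5 : 5 ≤ dU := by
    by_contra h
    push Not at h
    have h6 : triBound6 dU ≤ 6 := by
      interval_cases dU <;> decide
    omega
  have hrfin : M.eRk (⋃₀ ThmN.triangles M) ≠ ⊤ := by
    intro h
    have := M.eRk_le_encard (⋃₀ ThmN.triangles M)
    rw [h] at this
    exact hUfin.encard_lt_top.ne (top_le_iff.1 this)
  obtain ⟨r, hr⟩ := ENat.ne_top_iff_exists.1 hrfin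
  have hnat : (⋃₀ ThmN.triangles M).ncard = r + dU := by
    have h := hdUenc
    rw [hR, _root_.Matroid.restrict_ground_eq, _root_.Matroid.eRank_restrict, ← hr,
      ← hUfin.cast_ncard_eq] at h
    exact_mod_cast h
  have hr4 : 4 ≤ r := by
    by_contra h
    push Not at h
    have h3 : M.eRk (⋃₀ ThmN.triangles M) ≤ 3 := by
      rw [← hr]
      exact_mod_cast (show r ≤ 3 by omega)
    have := hC2 _ hUE h3
    omega
  omega

/-- **The final contradiction.** Two points `q ≠ q'` off `Cᵢ ∪ Cⱼ` (two triangles through `x`) in `cl(Cᵢ ∪ Cⱼ)` make a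
set of rank `≤ 3` with `7` points, against (C2). -/
theorem false_of_two_mem_closure_union_trianglesThrough (M : Matroid α) [M.Finite]
    (hC1 : ∀ L ⊆ M.E, M.eRk L = 2 → L.ncard ≤ 3)
    (hC2 : ∀ X ⊆ M.E, M.eRk X ≤ 3 → X.ncard ≤ 6) {x : α} (hx : M.IsNonloop x) {Ci Cj : Set α}
    (hCi : Ci ∈ ThmN.trianglesThrough M x) (hCj : Cj ∈ ThmN.trianglesThrough M x) (hij : Ci ≠ Cj)
    {q q' : α} (hqq' : q ≠ q') (hqE : q ∈ M.E) (hq'E : q' ∈ M.E) (hqCC : q ∉ Ci ∪ Cj) (hq'CC : q' ∉ Ci ∪ Cj)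
    (hq : q ∈ M.closure (Ci ∪ Cj)) (hq' : q' ∈ M.closure (Ci ∪ Cj)) : False := by
  have hCiE : Ci ⊆ M.E := hCi.1.subset_ground
  have hCjE : Cj ⊆ M.E := hCj.1.subset_ground
  have hCiCj : M.eRk (Ci ∪ Cj) ≤ 3 := eRk_union_le_three_of_trianglesThrough M hx hCi hCj
  have hWE : Ci ∪ Cj ∪ {q, q'} ⊆ M.E := by
    refine Set.union_subset (Set.union_subset hCiE hCjE) ?_
    exact Set.pair_subset hqE hq'E
  have hWcl : Ci ∪ Cj ∪ {q, q'} ⊆ M.closure (Ci ∪ Cj) := by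
    intro z hz
    rcases hz with hz | hz
    · exact M.subset_closure (Ci ∪ Cj) (Set.union_subset hCiE hCjE) hz
    · rcases hz with hz | hz
      · rw [hz]; exact hq
      · rw [Set.mem_singleton_iff.1 hz]; exact hq'
  have hrW : M.eRk (Ci ∪ Cj ∪ {q, q'}) ≤ 3 := by
    calc M.eRk (Ci ∪ Cj ∪ {q, q'}) ≤ M.eRk (M.closure (Ci ∪ Cj)) := M.eRk_mono hWcl
      _ = M.eRk (Ci ∪ Cj) := M.eRk_closure_eq _
      _ ≤ 3 := hCiCj
  have h6 := hC2 _ hWE hrW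
  have hinter : Ci ∩ Cj = {x} := ThmN.inter_eq_singleton_of_mem_trianglesThrough M hC1 hCi hCj hij
  have h5 : (Ci ∪ Cj).ncard = 5 := by
    have := Set.ncard_union_add_ncard_inter Ci Cj (M.ground_finite.subset hCiE) (M.ground_finite.subset hCjE)
    rw [hinter, ncard_singleton, hCi.2.1, hCj.2.1] at this
    omega
  have hdisj : Disjoint (Ci ∪ Cj) ({q, q'} : Set α) := by
    rw [Set.disjoint_left]
    intro z hz hz'
    rcases hz' with hz' | hz'
    · rw [hz'] at hz; exact hqCC hz
    · rw [Set.mem_singleton_iff.1 hz'] at hz; exact hq'CC hz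
  have h7 : (Ci ∪ Cj ∪ {q, q'}).ncard = 7 := by
    rw [Set.ncard_union_eq hdisj (M.ground_finite.subset (Set.union_subset hCiE hCjE))
      (M.ground_finite.subset (Set.pair_subset hqE hq'E)), h5, Set.ncard_pair hqq']
  omega

/-- **The type-finding step.** `s` contains every triangle through `x` (`hs'`), `y ∉ St := {x} ∪ ⋃ s`, every
point of a triangle through `y` lies in `St` or is `y` or `y'`; a family `𝒯` of triangles through `y` avoiding `y'`
meets `Ck ∈ s` only inside `K` with `|K| < |𝒯|`. Then some `T ∈ 𝒯` has `T ∖ {y} ⊆ ⋃ (s.erase Ck)`. -/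
theorem exists_triangle_sdiff_subset_erase (M : Matroid α) [M.Finite]
    (hC1 : ∀ L ⊆ M.E, M.eRk L = 2 → L.ncard ≤ 3) {x : α} (s : Finset (Set α))
    (hs' : ∀ C, C ∈ ThmN.trianglesThrough M x → C ∈ s)
    {y y' : α} (hySt : y ∉ ({x} ∪ ⋃ C ∈ s, C))
    (hcover : ∀ T ∈ ThmN.trianglesThrough M y, ∀ z ∈ T, z ∈ ({x} ∪ ⋃ C ∈ s, C) ∨ z = y ∨ z = y')
    {Ck : Set α} (hCk : Ck ∈ s) (𝒯 : Finset (Set α)) (h𝒯 : ∀ T ∈ 𝒯, T ∈ ThmN.trianglesThrough M y)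
    (h𝒯' : ∀ T ∈ 𝒯, y' ∉ T) (K : Finset α) (hK : ∀ T ∈ 𝒯, T ∩ Ck ⊆ ↑K) (hcard : K.card < 𝒯.card) :
    ∃ T ∈ 𝒯, T \ {y} ⊆ ⋃ C ∈ s.erase Ck, C := by
  have hTx : ∀ T ∈ ThmN.trianglesThrough M y, x ∉ T := by
    intro T hT hxT
    apply hySt
    have hTs : T ∈ s := hs' T ⟨hT.1, hT.2.1, hxT⟩
    exact Or.inr (Set.mem_iUnion₂.2 ⟨T, hTs, hT.2.2⟩)
  have hyCk : y ∉ Ck := fun h => hySt (Or.inr (Set.mem_iUnion₂.2 ⟨Ck, hCk, h⟩))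
  obtain ⟨T, hT, hTCk⟩ := exists_triangle_disjoint_of_card_lt M hC1 𝒯 h𝒯 hyCk K hK hcard
  refine ⟨T, hT, ?_⟩
  intro z hz
  have hzT : z ∈ T := hz.1
  have hzy : z ≠ y := fun h => hz.2 (by rw [h]; exact Set.mem_singleton y)
  rcases hcover T (h𝒯 T hT) z hzT with hzSt | hzy' | hzy'
  · rcases hzSt with hzx | hzC
    · exfalso
      exact hTx T (h𝒯 T hT) (by rw [← Set.mem_singleton_iff.1 hzx]; exact hzT)
    · obtain ⟨C, hC, hzC⟩ := Set.mem_iUnion₂.1 hzC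
      refine Set.mem_iUnion₂.2 ⟨C, Finset.mem_erase.2 ⟨?_, hC⟩, hzC⟩
      intro hCk'
      rw [hCk'] at hzC
      have hzTC : z ∈ T ∩ Ck := ⟨hzT, hzC⟩
      rw [hTCk] at hzTC
      exact hzTC
  · exact absurd hzy' hzy
  · exact absurd hzT (by rw [hzy']; exact h𝒯' T hT)

end S1

end PercRepro
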